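import Summits.QuantumFields.BalabanUV.T4Continuum.Support.ScalarBlockPoincare

/-!
# T⁴ programme, spine node NE2 (U1a), lane P2 — LEAF P⁺ OF THE VARIATIONAL ROUTE: THE COVARIANT BLOCK POINCARÉ INEQUALITY
# (coercivity of the covariant Dirichlet form on the constraint fibres) for the charged scalar (U(1) background = King's model),
# every torus, every level (`t4/skeletons/NE2-t4-ne2-p2.md` v0.5 §2.C; cell `pub-balaban`, row NE2 co-owner #2, lineage t4-ne2-p2 gen 10)

HONEST FRAMING (T4-DAG p. 1).  Rung (B)+1 only — NOT infinite volume, NOT a mass gap, NOT Clay.  Node NE2 is NOT IN PRINT and NOT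
proved here.  MODEL LEVEL: bond phases `R` (`‖R‖ ≤ 1`), site transports `T` (`‖T‖ ≤ 1`) and a GLOBAL unitary frame `G` are DATA; lattice
units; scalar (0-form) sector.  What is proved is OURS and elementary: the tree's `U = 1` block Poincaré inequality
`ScalarBlockPoincare.nsq_sub_PiS_le` (NE2 swarm, row B4.c) transported along the frame `G`, with the frame defects entering ADDITIVELY and
absorbed under an explicit GLOBAL SMALL-FIELD condition.  Nothing printed is a hypothesis; no `def … : Prop` fact; no `sorry`; axioms
standard.  HONEST DEPENDENCY (cell, verbatim): continuum YM on T⁴ ⇐ BetaPertH ∧ nine spine estimates (0/9 proved); BetaPertH ⇐ (D1) ∧ (D4)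
∧ CAP+tail; G-an2-4 gates asym, D1 and NE2/3/4.

THE STATEMENT (leaf P⁺, skeleton §2.C; printed context [Balaban1985BackgroundPropagators] Thm 3.11 p.416 «the operators Δ′_a, G′, …
are positive definite» — a uniform LOWER bound for the covariant averaged operator; here the 0-form torus version at model level).
Level `n = L^k`, torus `Tor (fine n M)` over the unit torus `Tor M`, blocks `B(z) = {bpt n M z j}`; for every field `f`:

  `Σ_x |f x|² ≤ 8·n^d·Σ_z |(Q_T f)(z)|² + 32d·n²·Σ_{x,μ} |R(x,μ)f(x+e_μ) − f(x)|²`      (`nsq_le_covariant_poincare`)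

where `(Q_T f)(z) = n^{−d}Σ_j T(bpt z j)·f(bpt z j)` is the transported block average ([B9] (3.19) shape, abelian), PROVIDED the
background is globally close to a pure gauge in the sense `|G(x+e_μ) − G(x)R(x,μ)| ≤ m_G` (bond defect of the frame),
`|G(bpt z j) − c(z)·T(bpt z j)| ≤ m_B` (the frame agrees with the block transports up to a block phase `c`, `|c| ≤ 1`) and
`16d²·(n·m_G)² + 4·m_B² ≤ 1/2`.  In physical units: `‖f‖²_{L²} ≤ 8·‖Q_T f‖²_{unit} + 32d·Sc(f)` (`Sc = n^{2−d}Σ|D_R f|²`) — the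
coercivity constant `C_P = 32d` of the skeleton's assembly, UNIFORM in `n`, the torus and the background class.  For a smooth U(1)
background of field strength `α` on the unit torus of side `M` in an axial gauge, `m_G ≍ αM/n` and `m_B ≍ dαM`: the condition is a
global small-field condition `αM ≪ 1`, uniform in `n` (located, model level; multi-region / Dirichlet versions are [B9]'s setting and
are NOT claimed).
-/

noncomputable section

namespace Summit.QuantumFields.BalabanUV.T4Continuum.VariationalCovariantPoincare

open Finset
open Literature.MathematicalPhysics.QuantumFieldTheory.Balaban1983to89
open Literature.MathematicalPhysics.QuantumFieldTheory.Balaban1983to89.B5Prop11Plancherel (Tor fine unitVec)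
open Literature.MathematicalPhysics.QuantumFieldTheory.Balaban1983to89.B5Prop11Lower (nsq nsq_nonneg)
open Literature.MathematicalPhysics.QuantumFieldTheory.Balaban1983to89.B5Action121 (sdiff sdiff_mulVec)
open Literature.MathematicalPhysics.QuantumFieldTheory.Balaban1983to89.B5Block118 (bpt QsOp QsOp_mulVec)
open Literature.MathematicalPhysics.QuantumFieldTheory.Balaban1983to89.B5AverageCurlStokes (sum_translate sum_blocks_real)
open scoped Matrix
open Summit.QuantumFields.BalabanUV.T4Continuum.ScalarBlockPoincare (PiS nsq_sub_PiS_le nsq_PiS_mulVec_eq nsq_add_le)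

variable {d : ℕ} (n : ℕ) [NeZero n] (M : Fin d → ℕ) [hM : ∀ μ, NeZero (M μ)]

/-- the transported block average over the unit blocks: `(Q_T f)(z) = n^{−d}Σ_j T(bpt z j)·f(bpt z j)` ([B9] (3.19) shape, abelian; the
same object as `VariationalCovariantFederbush.Qc n M T f`, restated by its defining sum to keep this leaf independent).
[cite: Balaban1985BackgroundPropagators, (3.19) p.393 (shape; abelian, site transports as data)] [folklore] -/
def QT (T : Tor (fine n M) → ℂ) (f : Tor (fine n M) → ℂ) (z : Tor M) : ℂ :=
  ((n : ℂ) ^ d)⁻¹ * ∑ j : Fin d → Fin n, T (bpt n M z j) * f (bpt n M z j)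

/-- the covariant Dirichlet sum `Σ_{μ} Σ_x |R(x,μ) f(x+e_μ) − f(x)|²` (lattice units; `= Σ_μ VariationalCovariantFederbush.dirU … μ`). [folklore] -/
def dirR (R : Tor (fine n M) → Fin d → ℂ) (f : Tor (fine n M) → ℂ) : ℝ :=
  ∑ μ, ∑ x, ‖R x μ * f (x + unitVec (fine n M) μ) - f x‖ ^ 2

/-- `nsq (G·f) = nsq f` for a unitary frame. [folklore] -/
theorem nsq_frame_mul {G : Tor (fine n M) → ℂ} (hG : ∀ x, ‖G x‖ = 1) (f : Tor (fine n M) → ℂ) :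
    nsq (fun x => G x * f x) = nsq f := by
  unfold nsq
  exact sum_congr rfl fun x _ => by rw [norm_mul, hG, one_mul]

omit [NeZero n] hM in
/-- pointwise: `g(x+e) − g(x) = (G(x+e) − G(x)R(x,ν))·f(x+e) + G(x)·(R(x,ν)f(x+e) − f(x))`, hence
`‖g(x+e) − g(x)‖ ≤ m_G‖f(x+e)‖ + ‖D_R f(x,ν)‖` for a unitary frame. [folklore] -/
theorem norm_frame_diff_le {R : Tor (fine n M) → Fin d → ℂ} {G : Tor (fine n M) → ℂ} (hG : ∀ x, ‖G x‖ = 1) {mG : ℝ}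
    (hframe : ∀ x μ, ‖G (x + unitVec (fine n M) μ) - G x * R x μ‖ ≤ mG) (f : Tor (fine n M) → ℂ) (x : Tor (fine n M)) (ν : Fin d) :
    ‖G (x + unitVec (fine n M) ν) * f (x + unitVec (fine n M) ν) - G x * f x‖
      ≤ mG * ‖f (x + unitVec (fine n M) ν)‖ + ‖R x ν * f (x + unitVec (fine n M) ν) - f x‖ := by
  have e : G (x + unitVec (fine n M) ν) * f (x + unitVec (fine n M) ν) - G x * f x
      = (G (x + unitVec (fine n M) ν) - G x * R x ν) * f (x + unitVec (fine n M) ν)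
        + G x * (R x ν * f (x + unitVec (fine n M) ν) - f x) := by ring
  rw [e]
  refine (norm_add_le _ _).trans (add_le_add ?_ ?_)
  · rw [norm_mul]; exact mul_le_mul_of_nonneg_right (hframe x ν) (norm_nonneg _)
  · rw [norm_mul, hG, one_mul]

/-- **STEP (i): the plain Dirichlet sum of the framed field** `g = G·f` is bounded by the covariant one plus the frame's bond defect:
`Σ_ν nsq (∂_ν g) ≤ 2n²·(Σ_{μ,x}|D_R f|² + d·m_G²·Σ|f|²)` (`∂_ν = n(S_ν − 1)`). [folklore] -/
theorem sum_nsq_sdiff_frame_le {R : Tor (fine n M) → Fin d → ℂ} {G : Tor (fine n M) → ℂ} (hG : ∀ x, ‖G x‖ = 1) {mG : ℝ}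
    (hframe : ∀ x μ, ‖G (x + unitVec (fine n M) μ) - G x * R x μ‖ ≤ mG) (f : Tor (fine n M) → ℂ) :
    ∑ ν, nsq (sdiff (fine n M) (n : ℂ) ν *ᵥ fun x => G x * f x)
      ≤ 2 * (n : ℝ) ^ 2 * (dirR n M R f + d * mG ^ 2 * nsq f) := by
  have per : ∀ ν : Fin d, nsq (sdiff (fine n M) (n : ℂ) ν *ᵥ fun x => G x * f x)
      ≤ (n : ℝ) ^ 2 * (2 * mG ^ 2 * nsq f + 2 * ∑ x, ‖R x ν * f (x + unitVec (fine n M) ν) - f x‖ ^ 2) := by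
    intro ν
    unfold nsq
    have hx : ∀ x : Tor (fine n M), ‖(sdiff (fine n M) (n : ℂ) ν *ᵥ fun x => G x * f x) x‖ ^ 2
        ≤ (n : ℝ) ^ 2 * (2 * (mG ^ 2 * ‖f (x + unitVec (fine n M) ν)‖ ^ 2)
            + 2 * ‖R x ν * f (x + unitVec (fine n M) ν) - f x‖ ^ 2) := by
      intro x
      rw [sdiff_mulVec, norm_mul, Complex.norm_natCast, mul_pow]
      refine mul_le_mul_of_nonneg_left ?_ (by positivity)
      have h1 := norm_frame_diff_le n M hG hframe f x ν
      have h2 := pow_le_pow_left₀ (norm_nonneg _) h1 2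
      refine h2.trans ?_
      -- `(a+b)² ≤ 2a² + 2b²` (the tree's `…RotorChain.add_sq_le_two_mul`, kept local to the QFT import cone)
      have h3 : (mG * ‖f (x + unitVec (fine n M) ν)‖ + ‖R x ν * f (x + unitVec (fine n M) ν) - f x‖) ^ 2
          ≤ 2 * (mG * ‖f (x + unitVec (fine n M) ν)‖) ^ 2 + 2 * ‖R x ν * f (x + unitVec (fine n M) ν) - f x‖ ^ 2 := by
        nlinarith [sq_nonneg (mG * ‖f (x + unitVec (fine n M) ν)‖ - ‖R x ν * f (x + unitVec (fine n M) ν) - f x‖)]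
      rw [mul_pow] at h3
      linarith
    refine (sum_le_sum fun x _ => hx x).trans ?_
    rw [← mul_sum, sum_add_distrib, ← mul_sum, ← mul_sum, ← mul_sum,
      sum_translate n M (fun x => ‖f x‖ ^ 2) (unitVec (fine n M) ν)]
    exact le_of_eq (by ring)
  refine (sum_le_sum fun ν _ => per ν).trans ?_
  rw [← mul_sum, sum_add_distrib, sum_const, Finset.card_univ, Fintype.card_fin, nsmul_eq_mul, ← mul_sum]
  unfold dirR
  exact le_of_eq (by ring)

/-- **STEP (ii): the block means of the framed field** against the transported averages:
`nsq (Π′ g) ≤ 2n^d·Σ_z|(Q_T f)(z)|² + 2m_B²·Σ|f|²`. [folklore] -/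
theorem nsq_PiS_frame_le {T G : Tor (fine n M) → ℂ} {c : Tor M → ℂ} (hc : ∀ z, ‖c z‖ ≤ 1) {mB : ℝ}
    (hblock : ∀ z j, ‖G (bpt n M z j) - c z * T (bpt n M z j)‖ ≤ mB) (f : Tor (fine n M) → ℂ) :
    nsq (PiS n M *ᵥ fun x => G x * f x) ≤ 2 * (n : ℝ) ^ d * ∑ z, ‖QT n M T f z‖ ^ 2 + 2 * mB ^ 2 * nsq f := by
  have hn : (0 : ℝ) < (n : ℝ) ^ d := by have := NeZero.ne n; positivity
  have hcard : ((Finset.univ : Finset (Fin d → Fin n)).card : ℝ) = (n : ℝ) ^ d := by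
    rw [Finset.card_univ, Fintype.card_fun, Fintype.card_fin, Fintype.card_fin]; push_cast; ring
  rw [nsq_PiS_mulVec_eq]
  -- pointwise on the unit lattice
  have hz : ∀ z : Tor M, ‖(QsOp n M *ᵥ fun x => G x * f x) z‖
      ≤ ‖QT n M T f z‖ + mB * (((n : ℝ) ^ d)⁻¹ * ∑ j : Fin d → Fin n, ‖f (bpt n M z j)‖) := by
    intro z
    have e : (QsOp n M *ᵥ fun x => G x * f x) z
        = c z * QT n M T f z
          + ((n : ℂ) ^ d)⁻¹ * ∑ j : Fin d → Fin n, (G (bpt n M z j) - c z * T (bpt n M z j)) * f (bpt n M z j) := by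
      simp only [QsOp_mulVec, QT, one_div]
      have hj : ∀ j : Fin d → Fin n, G (bpt n M z j) * f (bpt n M z j)
          = c z * (T (bpt n M z j) * f (bpt n M z j)) + (G (bpt n M z j) - c z * T (bpt n M z j)) * f (bpt n M z j) :=
        fun j => by ring
      simp_rw [hj]
      rw [sum_add_distrib, ← mul_sum]
      ring
    rw [e]
    refine (norm_add_le _ _).trans (add_le_add ?_ ?_)
    · rw [norm_mul]
      calc ‖c z‖ * ‖QT n M T f z‖ ≤ 1 * ‖QT n M T f z‖ := mul_le_mul_of_nonneg_right (hc z) (norm_nonneg _)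
        _ = _ := one_mul _
    · rw [norm_mul, norm_inv, norm_pow, Complex.norm_natCast, mul_comm mB, mul_assoc]
      refine mul_le_mul_of_nonneg_left ?_ (by positivity)
      rw [sum_mul]
      refine (norm_sum_le _ _).trans (sum_le_sum fun j _ => ?_)
      rw [norm_mul]
      calc ‖G (bpt n M z j) - c z * T (bpt n M z j)‖ * ‖f (bpt n M z j)‖ ≤ mB * ‖f (bpt n M z j)‖ :=
            mul_le_mul_of_nonneg_right (hblock z j) (norm_nonneg _)
        _ = ‖f (bpt n M z j)‖ * mB := mul_comm _ _
  -- square and Cauchy–Schwarz the defect mean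
  have hz2 : ∀ z : Tor M, (n : ℝ) ^ d * ‖(QsOp n M *ᵥ fun x => G x * f x) z‖ ^ 2
      ≤ 2 * (n : ℝ) ^ d * ‖QT n M T f z‖ ^ 2 + 2 * mB ^ 2 * ∑ j : Fin d → Fin n, ‖f (bpt n M z j)‖ ^ 2 := by
    intro z
    have h1 := pow_le_pow_left₀ (norm_nonneg _) (hz z) 2
    have h2 : (‖QT n M T f z‖ + mB * (((n : ℝ) ^ d)⁻¹ * ∑ j : Fin d → Fin n, ‖f (bpt n M z j)‖)) ^ 2
        ≤ 2 * ‖QT n M T f z‖ ^ 2 + 2 * (mB * (((n : ℝ) ^ d)⁻¹ * ∑ j : Fin d → Fin n, ‖f (bpt n M z j)‖)) ^ 2 := by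
      nlinarith [sq_nonneg (‖QT n M T f z‖ - mB * (((n : ℝ) ^ d)⁻¹ * ∑ j : Fin d → Fin n, ‖f (bpt n M z j)‖))]
    have hcs : (∑ j : Fin d → Fin n, ‖f (bpt n M z j)‖) ^ 2 ≤ (n : ℝ) ^ d * ∑ j : Fin d → Fin n, ‖f (bpt n M z j)‖ ^ 2 := by
      have h := sq_sum_le_card_mul_sum_sq (s := (Finset.univ : Finset (Fin d → Fin n))) (f := fun j => ‖f (bpt n M z j)‖)
      rwa [hcard] at h
    have h3 : (n : ℝ) ^ d * (mB * (((n : ℝ) ^ d)⁻¹ * ∑ j : Fin d → Fin n, ‖f (bpt n M z j)‖)) ^ 2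
        ≤ mB ^ 2 * ∑ j : Fin d → Fin n, ‖f (bpt n M z j)‖ ^ 2 := by
      rw [mul_pow, mul_pow, inv_pow]
      calc (n : ℝ) ^ d * (mB ^ 2 * ((((n : ℝ) ^ d) ^ 2)⁻¹ * (∑ j : Fin d → Fin n, ‖f (bpt n M z j)‖) ^ 2))
          ≤ (n : ℝ) ^ d * (mB ^ 2 * ((((n : ℝ) ^ d) ^ 2)⁻¹ * ((n : ℝ) ^ d * ∑ j : Fin d → Fin n, ‖f (bpt n M z j)‖ ^ 2))) := by
            gcongr
        _ = mB ^ 2 * ∑ j : Fin d → Fin n, ‖f (bpt n M z j)‖ ^ 2 := by field_simp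
    nlinarith [mul_le_mul_of_nonneg_left h1 hn.le, mul_le_mul_of_nonneg_left h2 hn.le]
  unfold nsq
  rw [mul_sum]
  refine (sum_le_sum fun z _ => hz2 z).trans ?_
  rw [sum_add_distrib, ← mul_sum, ← mul_sum, ← sum_blocks_real n M (fun x => ‖f x‖ ^ 2)]

/-- **LEAF P⁺ (lattice units): THE COVARIANT BLOCK POINCARÉ INEQUALITY** under a global small-field frame:
`Σ_x |f x|² ≤ 8·n^d·Σ_z |(Q_T f)(z)|² + 32d·n²·Σ_{μ,x} |R(x,μ)f(x+e_μ) − f(x)|²`.  Physical units (`÷ n^d`):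
`‖f‖²_{L²} ≤ 8‖Q_T f‖²_{unit} + 32d·Sc(f)` — coercivity of the covariant Dirichlet form on the constraint fibres, uniform in `n`, the torus
and the background class. [folklore] -/
theorem nsq_le_covariant_poincare {R : Tor (fine n M) → Fin d → ℂ} {T G : Tor (fine n M) → ℂ} {c : Tor M → ℂ}
    (hG : ∀ x, ‖G x‖ = 1) (hc : ∀ z, ‖c z‖ ≤ 1) {mG mB : ℝ}
    (hframe : ∀ x μ, ‖G (x + unitVec (fine n M) μ) - G x * R x μ‖ ≤ mG)
    (hblock : ∀ z j, ‖G (bpt n M z j) - c z * T (bpt n M z j)‖ ≤ mB)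
    (hsmall : 16 * (d : ℝ) ^ 2 * ((n : ℝ) * mG) ^ 2 + 4 * mB ^ 2 ≤ 1 / 2) (f : Tor (fine n M) → ℂ) :
    nsq f ≤ 8 * (n : ℝ) ^ d * ∑ z, ‖QT n M T f z‖ ^ 2 + 32 * d * (n : ℝ) ^ 2 * dirR n M R f := by
  set g : Tor (fine n M) → ℂ := fun x => G x * f x with hg
  have hgf : nsq g = nsq f := nsq_frame_mul n M hG f
  have hsplit : nsq g ≤ 2 * nsq (g - PiS n M *ᵥ g) + 2 * nsq (PiS n M *ᵥ g) := by
    have h := nsq_add_le (g - PiS n M *ᵥ g) (PiS n M *ᵥ g)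
    rwa [sub_add_cancel] at h
  have hP := nsq_sub_PiS_le n M g
  have h1 := sum_nsq_sdiff_frame_le n M hG hframe f
  have h2 := nsq_PiS_frame_le n M hc hblock f
  have hd : (0 : ℝ) ≤ d := Nat.cast_nonneg d
  have hD : 0 ≤ dirR n M R f := sum_nonneg fun _ _ => sum_nonneg fun _ _ => by positivity
  have hQ : 0 ≤ ∑ z, ‖QT n M T f z‖ ^ 2 := sum_nonneg fun _ _ => by positivity
  have hf0 : 0 ≤ nsq f := nsq_nonneg f
  rw [← hg] at h1 h2
  rw [← hgf] at h1 h2 ⊢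
  set S := ∑ ν, nsq (sdiff (fine n M) (n : ℂ) ν *ᵥ g) with hS
  set D := dirR n M R f with hDdef
  set Q := ∑ z, ‖QT n M T f z‖ ^ 2 with hQdef
  have hg0 : 0 ≤ nsq g := nsq_nonneg g
  have s1 : nsq g ≤ 2 * (4 * d * S) + 2 * (2 * (n : ℝ) ^ d * Q + 2 * mB ^ 2 * nsq g) :=
    hsplit.trans (add_le_add (mul_le_mul_of_nonneg_left hP (by norm_num)) (mul_le_mul_of_nonneg_left h2 (by norm_num)))
  have s2 : 4 * (d : ℝ) * S ≤ 4 * d * (2 * (n : ℝ) ^ 2 * (D + d * mG ^ 2 * nsq g)) :=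
    mul_le_mul_of_nonneg_left h1 (by positivity)
  have key : nsq g ≤ 16 * d * (n : ℝ) ^ 2 * D + 4 * (n : ℝ) ^ d * Q
      + (16 * (d : ℝ) ^ 2 * ((n : ℝ) * mG) ^ 2 + 4 * mB ^ 2) * nsq g := by
    have e : (16 * (d : ℝ) ^ 2 * ((n : ℝ) * mG) ^ 2 + 4 * mB ^ 2) * nsq g
        = 16 * (d : ℝ) ^ 2 * (n : ℝ) ^ 2 * mG ^ 2 * nsq g + 4 * mB ^ 2 * nsq g := by ring
    rw [e]
    nlinarith [s1, s2]
  nlinarith [key, mul_le_mul_of_nonneg_right hsmall hg0]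

end Summit.QuantumFields.BalabanUV.T4Continuum.VariationalCovariantPoincare

end
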